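import Literature.Probability.Process.RootedHardCoreVague
import Mathlib.MeasureTheory.Constructions.Polish.Basic
import Mathlib.Analysis.Normed.Affine.AddTorsor

/-!
# Benjamini–Schramm limit of ground states, I: the counting-measure map is a measurable embedding

Route `PalmUnimodularRigidity`, item `stmt-AtomisticToContinuum-9230` (`BenjaminiSchrammLimit`),
helper file 1.

The Benjamini–Schramm (local weak) limit is taken on the compact metric space
`RootedHardCoreConfig E δ` of rooted `δ`-hard-core configurations (Literature:
`Probability/Process/RootedHardCoreConfig.lean`) and then pushed to a law
`P : Measure (Measure E)` along `S ↦ count|S`. For the push-forward to behave like the original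
law for ALL sets and ALL integrands (outer measures of non-measurable events in the density-transfer
clause, iterated integrals whose integrand is not known to be Giry-measurable) we show that
`S ↦ count|S` is a `MeasurableEmbedding` (`measurableEmbedding_toMeasure`). The two inputs:

* `measurableSet_setOf_isRootedHardCore` — RECOGNITION LEMMA: for `δ > 0` the rooted `δ`-hard-core
  counting measures form a Giry-measurable set of measures: `μ` is one iff `μ {0} = 1` and every
  open ball of rational radius `< δ/2` about a point of a dense sequence has `μ`-mass `0` or `1`
  (countably many evaluations).
* `hasCountableSeparatingOn_isRootedHardCore` — the same countable family of evaluations separates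
  rooted hard-core counting measures, so Lusin–Souslin (`Measurable.measurableEmbedding`) applies to
  the corestriction of `S ↦ count|S` to its (standard Borel) range.
-/

noncomputable section

open MeasureTheory Set Filter Metric TopologicalSpace
open scoped Topology ENNReal

namespace Summit.AtomisticToContinuum.Crystallization.Theorems.BenjaminiSchrammLimit

open Literature.Probability.Process Literature.Probability.Process.LocalConfig

section Recognition

variable {E : Type*} [NormedAddCommGroup E] [NormedSpace ℝ E] [ProperSpace E] [MeasurableSpace E]
  [BorelSpace E]

omit [NormedSpace ℝ E] [MeasurableSpace E] [BorelSpace E] in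
/-- Small rational balls about a dense sequence form a basis: every ball `ball p r` contains one of
them containing `p`, of radius `< δ / 2`. [folklore] -/
theorem exists_small_ball {δ : ℝ} (hδ : 0 < δ) (p : E) {r : ℝ} (hr : 0 < r) :
    ∃ n : ℕ, ∃ q : ℚ, 0 < (q : ℝ) ∧ (q : ℝ) < δ / 2 ∧ p ∈ ball (denseSeq E n) q ∧
      ball (denseSeq E n) q ⊆ ball p r := by
  obtain ⟨q, hq0, hq⟩ := exists_rat_btwn (lt_min (half_pos hr) (half_pos hδ))
  have hq0' : (0 : ℝ) < q := by exact_mod_cast hq0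
  obtain ⟨n, hn⟩ := (denseRange_denseSeq E).exists_dist_lt p hq0'
  refine ⟨n, q, hq0', hq.trans_le (min_le_right _ _), ?_, fun z hz => ?_⟩
  · rwa [mem_ball]
  · rw [mem_ball] at hz ⊢
    have h1 : (q : ℝ) < r / 2 := hq.trans_le (min_le_left _ _)
    calc dist z p ≤ dist z (denseSeq E n) + dist p (denseSeq E n) := dist_triangle_right _ _ _
      _ < q + q := add_lt_add hz hn
      _ < r := by linarith

omit [NormedSpace ℝ E] in
/-- A rooted `δ`-hard-core counting measure gives mass `0` or `1` to every open ball of radius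
`< δ / 2` (two points of the configuration in such a ball would be `< δ` apart). [folklore] -/
theorem measure_ball_small_of_isRootedHardCore {δ : ℝ} {μ : Measure E} (h : IsRootedHardCore δ μ)
    (c : E) {r : ℝ} (hr : r < δ / 2) : μ (ball c r) = 0 ∨ μ (ball c r) = 1 := by
  obtain ⟨S, -, hsep, rfl⟩ := h
  rw [Measure.restrict_apply measurableSet_ball]
  have hsub : (ball c r ∩ S).Subsingleton := by
    intro x hx y hy
    by_contra hxy
    have h1 := hsep x hx.2 y hy.2 hxy
    have h2 : dist x y < δ :=
      calc dist x y ≤ dist x c + dist y c := dist_triangle_right _ _ _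
        _ < r + r := add_lt_add (mem_ball.1 hx.1) (mem_ball.1 hy.1)
        _ < δ := by linarith
    linarith
  rcases hsub.eq_empty_or_singleton with h | ⟨x, hx⟩
  · left
    rw [h, measure_empty]
  · right
    rw [hx, Measure.count_singleton]

/-- **Recognition lemma.** For `δ > 0`, a measure `μ` on `E` is the counting measure of a
`δ`-separated set containing `0` iff `μ {0} = 1` and every open ball of rational radius `< δ/2`
about a point of the dense sequence has `μ`-mass `0` or `1`. [folklore] -/
theorem isRootedHardCore_iff_balls {δ : ℝ} (hδ : 0 < δ) (μ : Measure E) :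
    IsRootedHardCore δ μ ↔ μ {0} = 1 ∧ ∀ n : ℕ, ∀ q : ℚ, (q : ℝ) < δ / 2 →
      μ (ball (denseSeq E n) q) = 0 ∨ μ (ball (denseSeq E n) q) = 1 := by
  constructor
  · intro h
    exact ⟨h.measure_zero_singleton, fun n q hq => measure_ball_small_of_isRootedHardCore h _ hq⟩
  rintro ⟨h0, hball⟩
  -- the null open set `U₀` and the closed carrier `S`
  set U₀ : Set E := ⋃ (n : ℕ) (q : ℚ) (_ : (q : ℝ) < δ / 2 ∧ μ (ball (denseSeq E n) q) = 0),
    ball (denseSeq E n) q with hU₀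
  have hU₀null : μ U₀ = 0 := by
    rw [hU₀]
    refine measure_iUnion_null fun n => measure_iUnion_null fun q => ?_
    refine measure_iUnion_null fun hq => hq.2
  set S : Set E := U₀ᶜ with hS
  -- basis balls about a point of `S` have mass one
  have hone : ∀ p ∈ S, ∀ n : ℕ, ∀ q : ℚ, (q : ℝ) < δ / 2 → p ∈ ball (denseSeq E n) q →
      μ (ball (denseSeq E n) q) = 1 := by
    intro p hp n q hq hpB
    rcases hball n q hq with h | h
    · exact absurd (mem_iUnion₂.2 ⟨n, q, mem_iUnion.2 ⟨⟨hq, h⟩, hpB⟩⟩) hp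
    · exact h
  -- `S` is `δ`-separated
  have hsep : ∀ x ∈ S, ∀ y ∈ S, x ≠ y → δ ≤ dist x y := by
    intro x hx y hy hxy
    by_contra hlt
    rw [not_le] at hlt
    have hxy0 : 0 < dist x y := dist_pos.2 hxy
    -- a ball `B` of radius `< δ/2` about a point near the midpoint, containing `x` and `y`
    set m : E := midpoint ℝ x y with hm
    have hmx : dist x m = dist x y / 2 := by
      rw [hm, dist_left_midpoint, Real.norm_ofNat]
      ring
    have hmy : dist y m = dist x y / 2 := by
      rw [hm, dist_right_midpoint, Real.norm_ofNat]
      ring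
    obtain ⟨ρ, hρ1, hρ2⟩ := exists_rat_btwn (show dist x y / 2 < δ / 2 by linarith)
    have hρ0 : (0 : ℝ) < ρ := by linarith
    obtain ⟨n, hn⟩ := (denseRange_denseSeq E).exists_dist_lt m (show 0 < (ρ : ℝ) - dist x y / 2
      by linarith)
    have hxB : x ∈ ball (denseSeq E n) ρ := by
      rw [mem_ball]
      calc dist x (denseSeq E n) ≤ dist x m + dist m (denseSeq E n) := dist_triangle _ _ _
        _ < dist x y / 2 + (ρ - dist x y / 2) := add_lt_add_of_le_of_lt hmx.le hn
        _ = ρ := by ring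
    have hyB : y ∈ ball (denseSeq E n) ρ := by
      rw [mem_ball]
      calc dist y (denseSeq E n) ≤ dist y m + dist m (denseSeq E n) := dist_triangle _ _ _
        _ < dist x y / 2 + (ρ - dist x y / 2) := add_lt_add_of_le_of_lt hmy.le hn
        _ = ρ := by ring
    have hB1 : μ (ball (denseSeq E n) ρ) = 1 := hone x hx n ρ hρ2 hxB
    -- disjoint sub-balls about `x` and `y`
    obtain ⟨rx, hrx, hrxB⟩ := Metric.isOpen_iff.1 isOpen_ball x hxB
    obtain ⟨ry, hry, hryB⟩ := Metric.isOpen_iff.1 isOpen_ball y hyB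
    obtain ⟨nx, qx, -, hqx, hxBx, hBx⟩ :=
      exists_small_ball hδ x (lt_min hrx (half_pos hxy0))
    obtain ⟨ny, qy, -, hqy, hyBy, hBy⟩ :=
      exists_small_ball hδ y (lt_min hry (half_pos hxy0))
    have hBx1 : μ (ball (denseSeq E nx) qx) = 1 := hone x hx nx qx hqx hxBx
    have hBy1 : μ (ball (denseSeq E ny) qy) = 1 := hone y hy ny qy hqy hyBy
    have hdisj : Disjoint (ball (denseSeq E nx) qx) (ball (denseSeq E ny) qy) := by
      rw [Set.disjoint_left]
      intro z hzx hzy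
      have h1 : dist z x < dist x y / 2 :=
        (mem_ball.1 (hBx hzx)).trans_le (min_le_right _ _)
      have h2 : dist z y < dist x y / 2 :=
        (mem_ball.1 (hBy hzy)).trans_le (min_le_right _ _)
      have := dist_triangle_left x y z
      linarith
    have hsub : ball (denseSeq E nx) qx ∪ ball (denseSeq E ny) qy ⊆ ball (denseSeq E n) ρ :=
      union_subset (hBx.trans ((ball_subset_ball (min_le_left _ _)).trans hrxB))
        (hBy.trans ((ball_subset_ball (min_le_left _ _)).trans hryB))
    have h2 : (2 : ℝ≥0∞) ≤ 1 :=
      calc (2 : ℝ≥0∞) = μ (ball (denseSeq E nx) qx) + μ (ball (denseSeq E ny) qy) := by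
            rw [hBx1, hBy1]; norm_num
        _ = μ (ball (denseSeq E nx) qx ∪ ball (denseSeq E ny) qy) :=
            (measure_union hdisj measurableSet_ball).symm
        _ ≤ μ (ball (denseSeq E n) ρ) := measure_mono hsub
        _ = 1 := hB1
    exact absurd h2 (by norm_num)
  -- points of `S` carry mass one
  have hpt : ∀ p ∈ S, μ {p} = 1 := by
    intro p hp
    obtain ⟨n, q, -, hq, hpB, hB⟩ := exists_small_ball hδ p (half_pos hδ)
    have hB1 : μ (ball (denseSeq E n) q) = 1 := hone p hp n q hq hpB
    refine le_antisymm ?_ ?_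
    · calc μ {p} ≤ μ (ball (denseSeq E n) q) := measure_mono (singleton_subset_iff.2 hpB)
        _ = 1 := hB1
    · have hrest : μ (ball (denseSeq E n) q \ {p}) = 0 := by
        refine measure_mono_null (fun z hz => ?_) hU₀null
        by_contra hzU
        have hzS : z ∈ S := hzU
        have hzp : z ≠ p := hz.2
        have h1 := hsep z hzS p hp hzp
        have h2 : dist z p < δ / 2 := mem_ball.1 (hB hz.1)
        linarith
      calc (1 : ℝ≥0∞) = μ (ball (denseSeq E n) q) := hB1.symm
        _ ≤ μ ({p} ∪ (ball (denseSeq E n) q \ {p})) := by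
            refine measure_mono ?_
            rw [union_sdiff_self]
            exact subset_union_right
        _ ≤ μ {p} + μ (ball (denseSeq E n) q \ {p}) := measure_union_le _ _
        _ = μ {p} := by rw [hrest, add_zero]
  -- the root
  have h0S : (0 : E) ∈ S := by
    by_contra h0S
    have : μ {0} = 0 := measure_mono_null (singleton_subset_iff.2 (not_notMem.1 h0S)) hU₀null
    rw [h0] at this
    exact one_ne_zero this
  -- `S` is countable
  have hScount : S.Countable := by
    have : S = ⋃ n : ℕ, closedBall (0 : E) n ∩ S := by
      ext x
      simp only [mem_iUnion, mem_inter_iff]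
      exact ⟨fun hx => ⟨⌈‖x‖⌉₊, mem_closedBall_zero_iff.2 (Nat.le_ceil _), hx⟩,
        fun ⟨_, _, hx⟩ => hx⟩
    rw [this]
    exact countable_iUnion fun n =>
      (finite_inter_of_separated hδ hsep (isCompact_closedBall _ _)).countable
  -- `μ = count|S`
  refine ⟨S, h0S, hsep, Measure.ext fun A hA => ?_⟩
  have key : ∀ ν : Measure E, (∀ p ∈ S, ν {p} = 1) → ν (A ∩ S) = ∑' _ : ↥(A ∩ S), (1 : ℝ≥0∞) := by
    intro ν hν
    have h := measure_biUnion (μ := ν) (f := fun p : E => ({p} : Set E))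
      (hScount.mono (inter_subset_right (s := A)))
      (fun p _ q _ hpq => disjoint_singleton.2 hpq) fun p _ => measurableSet_singleton p
    rw [biUnion_of_singleton] at h
    rw [h]
    exact tsum_congr fun p => hν p p.2.2
  have hAS : μ (A ∩ S) = ∑' _ : ↥(A ∩ S), (1 : ℝ≥0∞) := key μ hpt
  have hcount : (Measure.count : Measure E).restrict S A = ∑' _ : ↥(A ∩ S), (1 : ℝ≥0∞) := by
    rw [Measure.restrict_apply hA]
    exact key _ fun p _ => Measure.count_singleton p
  have hAc : μ (A \ S) = 0 := measure_mono_null (fun z hz => not_notMem.1 hz.2) hU₀null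
  have hSm : MeasurableSet S := (isClosed_of_separated hδ hsep).measurableSet
  rw [hcount, ← hAS, ← measure_inter_add_sdiff A hSm, hAc, add_zero]

/-- **The rooted `δ`-hard-core counting measures form a Giry-measurable set of measures**
(`δ > 0`): cut out by countably many evaluations (`isRootedHardCore_iff_balls`). [folklore] -/
theorem measurableSet_setOf_isRootedHardCore {δ : ℝ} (hδ : 0 < δ) :
    MeasurableSet {μ : Measure E | IsRootedHardCore δ μ} := by
  have hrepr : {μ : Measure E | IsRootedHardCore δ μ} = {μ : Measure E | μ {0} = 1} ∩
      ⋂ (n : ℕ) (q : ℚ), {μ : Measure E | (q : ℝ) < δ / 2 →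
        μ (ball (denseSeq E n) q) = 0 ∨ μ (ball (denseSeq E n) q) = 1} := by
    ext μ
    simp only [mem_setOf_eq, isRootedHardCore_iff_balls hδ, mem_inter_iff, mem_iInter]
  rw [hrepr]
  refine MeasurableSet.inter
    (Measure.measurable_coe (measurableSet_singleton 0) (measurableSet_singleton 1))
    (MeasurableSet.iInter fun n => MeasurableSet.iInter fun q => ?_)
  by_cases hq : (q : ℝ) < δ / 2
  · have hm := Measure.measurable_coe (α := E) (measurableSet_ball (x := denseSeq E n) (ε := q))
    have h01 : MeasurableSet ({μ : Measure E | μ (ball (denseSeq E n) q) = 0} ∪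
        {μ : Measure E | μ (ball (denseSeq E n) q) = 1}) :=
      (hm (measurableSet_singleton 0)).union (hm (measurableSet_singleton 1))
    convert h01 using 1
    ext μ
    simp only [mem_setOf_eq, hq, true_imp_iff, mem_union]
  · convert MeasurableSet.univ (α := Measure E)
    ext μ
    simp only [mem_setOf_eq, hq, false_imp_iff, mem_univ]

omit [NormedSpace ℝ E] in
/-- **Countably many evaluations separate rooted hard-core counting measures** (`δ > 0`): two
`δ`-separated closed carriers that meet the same small rational balls are equal. [folklore] -/
theorem hasCountableSeparatingOn_isRootedHardCore {δ : ℝ} (hδ : 0 < δ) :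
    HasCountableSeparatingOn (Measure E) MeasurableSet {μ : Measure E | IsRootedHardCore δ μ} := by
  refine ⟨⟨Set.range fun nq : ℕ × ℚ =>
    {μ : Measure E | μ (ball (denseSeq E nq.1) nq.2) = 0}, countable_range _, ?_, ?_⟩⟩
  · rintro _ ⟨nq, rfl⟩
    exact Measure.measurable_coe measurableSet_ball (measurableSet_singleton 0)
  · intro μ hμ ν hν h
    obtain ⟨S, -, hS, rfl⟩ := hμ
    obtain ⟨T, -, hT, rfl⟩ := hν
    have h' : ∀ n : ℕ, ∀ q : ℚ,
        (Measure.count : Measure E).restrict S (ball (denseSeq E n) q) = 0 ↔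
          (Measure.count : Measure E).restrict T (ball (denseSeq E n) q) = 0 :=
      fun n q => h _ ⟨(n, q), rfl⟩
    suffices key : ∀ S T : Set E, (∀ x ∈ T, ∀ y ∈ T, x ≠ y → δ ≤ dist x y) →
        (∀ n : ℕ, ∀ q : ℚ, (Measure.count : Measure E).restrict S (ball (denseSeq E n) q) = 0 ↔
          (Measure.count : Measure E).restrict T (ball (denseSeq E n) q) = 0) → S ⊆ T by
      rw [Subset.antisymm (key S T hT h') (key T S hS fun n q => (h' n q).symm)]
    intro S T hT h p hp
    by_contra hpT
    obtain ⟨r, hr, hball⟩ :=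
      Metric.isOpen_iff.1 (isClosed_of_separated hδ hT).isOpen_compl p hpT
    obtain ⟨n, q, -, -, hpB, hB⟩ := exists_small_ball hδ p hr
    have hT0 : (Measure.count : Measure E).restrict T (ball (denseSeq E n) q) = 0 := by
      rw [Measure.restrict_apply measurableSet_ball, Measure.count_eq_zero_iff]
      exact Set.eq_empty_of_forall_notMem fun z hz => hball (hB hz.1) hz.2
    have hS0 := (h n q).2 hT0
    rw [Measure.restrict_apply measurableSet_ball, Measure.count_eq_zero_iff] at hS0
    exact (Set.eq_empty_iff_forall_notMem.1 hS0) p ⟨hpB, hp⟩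

variable (E) in
/-- **The counting-measure map is a measurable embedding** of the compact metric space of rooted
`δ`-hard-core configurations (`δ > 0`, `E` proper) into `Measure E` with the Giry σ-algebra: it is
measurable (`measurable_toMeasure`), injective, its range is the measurable set of rooted hard-core
counting measures, on which countably many evaluations separate points, so Lusin–Souslin applies.
Consequently push-forwards of laws along it keep all outer measures and all integrals
(`MeasurableEmbedding.map_apply`, `.lintegral_map`, `.integral_map`). [folklore] -/
theorem measurableEmbedding_toMeasure {δ : ℝ} [Fact (0 < δ)] :
    MeasurableEmbedding fun S : RootedHardCoreConfig E δ => (S.1 : LocalConfig E).toMeasure := by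
  have hδ : 0 < δ := Fact.out
  have hG : MeasurableSet {μ : Measure E | IsRootedHardCore δ μ} :=
    measurableSet_setOf_isRootedHardCore hδ
  haveI : MeasurableSpace.CountablySeparated {μ : Measure E | IsRootedHardCore δ μ} :=
    MeasurableSpace.CountablySeparated.subtype_iff.2 (hasCountableSeparatingOn_isRootedHardCore hδ)
  let e' : RootedHardCoreConfig E δ → {μ : Measure E | IsRootedHardCore δ μ} := fun S =>
    ⟨(S.1 : LocalConfig E).toMeasure, (isRootedHardCore_toMeasure_iff δ S.1).2 S.2⟩
  have he' : Measurable e' := (measurable_toMeasure hδ).subtype_mk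
  have hinj : Function.Injective e' := fun S T h =>
    Subtype.ext (toMeasure_injective (congrArg Subtype.val h))
  exact (MeasurableEmbedding.subtype_coe hG).comp (he'.measurableEmbedding hinj)

end Recognition

end Summit.AtomisticToContinuum.Crystallization.Theorems.BenjaminiSchrammLimit
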